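import Mathlib.ModelTheory.Algebra.Ring.FreeCommRing
import Literature.NumberTheory.DiophantineGeometry.PlaneCurveNonsingularPointProofs
import Literature.ModelTheory.PseudofiniteFields.DefinableSetsFiniteFieldsTransferProofs
import Literature.ModelTheory.PseudofiniteFields.DefinablePredicates
import HarnessLib

/-!
# Pseudo-finite fields are PAC for plane curves (by transfer of the Weil bound)

Topic `Literature/ModelTheory/PseudofiniteFields`.  Main result:

* `planeCurve_infinite_of_nonsingular_psf` — over a pseudo-finite field `K` (an infinite model of
  the theory of finite fields, `FiniteFieldTheory.lean`), for all `F, Q ∈ K[X][Y]` and `(a, b)`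
  with `F(a,b) = 0`, `∂_Y F(a,b) ≠ 0`, `Q(a,b) ≠ 0`, the set `{(a',b') | F(a',b') = 0 ≠ Q(a',b')}`
  is infinite.

This is the plane-curve case of "pseudo-finite fields are pseudo-algebraically closed"
(Ax 1968, via the Riemann hypothesis for curves); here it is obtained by TRANSFER from the
uniform finite-field count
`Literature.NumberTheory.DiophantineGeometry.PlaneShear.exists_le_ncard_zeros_of_nonsingular`:
the coefficients of `F, Q` (of bounded degrees) and the point `(a, b)` are the free variables of
ONE ring formula "`F(a,b) = 0 ∧ ∂_Y F(a,b) ≠ 0 ∧ Q(a,b) ≠ 0 →` there are `n` distinct points of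
`{F = 0, Q ≠ 0}`" (built with the generic polynomial `genPoly` and
`FirstOrder.Ring.termOfFreeCommRing`, plus the closure properties of `DefinablePredicates.lean`),
which holds in all finite fields with `≥ q₀(N, n)` elements and therefore in every pseudo-finite
field (`realize_formula_of_forall_finite`).

Genuine definitions: `genPoly` (the generic bivariate polynomial of bidegree `≤ (N, N)`),
`genPolyFR`, `genPolyDerivFR` (the corresponding free-ring elements), `CoeffIdx`.  No named facts.

## References

* J. Ax, *The elementary theory of finite fields*, Ann. of Math. 88 (1968) 239–271, §§7–8
  (pseudo-finite fields are PAC, by the Riemann hypothesis for curves). [Ax1968]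
* Z. Chatzidakis, L. van den Dries, A. Macintyre, *Definable sets over finite fields*, J. reine
  angew. Math. 427 (1992) 107–135, p. 110 and (2.3) (transfer). [ChatzidakisVanDenDriesMacintyre1992]
-/


namespace Literature.ModelTheory.PseudofiniteFields

open FirstOrder FirstOrder.Language FirstOrder.Ring Polynomial
open scoped Polynomial.Bivariate

section GenPoly

variable {K : Type*} [CommRing K] {N : ℕ}

/-- The generic bivariate polynomial `Σ_{i,j ≤ N} c_{ij} X^i Y^j` with coefficient vector `c`.
[folklore] -/
noncomputable def genPoly (N : ℕ) (c : Fin (N + 1) × Fin (N + 1) → K) : K[X][Y] :=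
  ∑ ij : Fin (N + 1) × Fin (N + 1), C (C (c ij) * X ^ (ij.1 : ℕ)) * Y ^ (ij.2 : ℕ)

/-- Coefficients of the generic polynomial. [folklore] -/
theorem coeff_coeff_genPoly (c : Fin (N + 1) × Fin (N + 1) → K) (k j : ℕ) :
    ((genPoly N c).coeff k).coeff j =
      if h : j ≤ N ∧ k ≤ N then c (⟨j, by omega⟩, ⟨k, by omega⟩) else 0 := by
  classical
  rw [genPoly, finsetSum_coeff, finsetSum_coeff]
  simp only [coeff_C_mul_X_pow]
  split_ifs with h
  · rw [Finset.sum_eq_single (⟨j, by omega⟩, ⟨k, by omega⟩)]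
    · simp
    · rintro ⟨i', k'⟩ - hne
      by_cases hk : k = (k' : ℕ)
      · rw [if_pos hk, coeff_C_mul_X_pow, if_neg]
        intro hj
        apply hne
        ext <;> simp [hk, hj]
      · rw [if_neg hk, coeff_zero]
    · intro habs; exact absurd (Finset.mem_univ _) habs
  · refine Finset.sum_eq_zero fun ij _ => ?_
    by_cases hk : k = (ij.2 : ℕ)
    · rw [if_pos hk, coeff_C_mul_X_pow, if_neg]
      intro hj
      apply h
      exact ⟨hj ▸ Nat.lt_succ_iff.1 ij.1.isLt, hk ▸ Nat.lt_succ_iff.1 ij.2.isLt⟩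
    · rw [if_neg hk, coeff_zero]

/-- A polynomial of `Y`-degree `≤ N` whose coefficients have `X`-degree `≤ N` IS the generic
polynomial at its coefficient vector. [folklore] -/
theorem genPoly_coeff_eq (F : K[X][Y]) (hd : F.natDegree ≤ N)
    (hc : ∀ k, (F.coeff k).natDegree ≤ N) :
    genPoly N (fun ij => (F.coeff ij.2).coeff ij.1) = F := by
  ext k j
  rw [coeff_coeff_genPoly]
  split_ifs with h
  · rfl
  · rw [not_and_or, not_le, not_le] at h
    rcases h with hj | hk
    · exact (coeff_eq_zero_of_natDegree_lt ((hc k).trans_lt hj)).symm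
    · rw [coeff_eq_zero_of_natDegree_lt (hd.trans_lt hk), coeff_zero]

/-- Degree bounds of the generic polynomial. [folklore] -/
theorem natDegree_genPoly_le (c : Fin (N + 1) × Fin (N + 1) → K) : (genPoly N c).natDegree ≤ N := by
  rw [natDegree_le_iff_coeff_eq_zero]
  intro k hk
  ext j
  rw [coeff_coeff_genPoly, dif_neg (fun h => by omega), coeff_zero]

/-- Degree bounds of the coefficients of the generic polynomial. [folklore] -/
theorem natDegree_coeff_genPoly_le (c : Fin (N + 1) × Fin (N + 1) → K) (k : ℕ) :
    ((genPoly N c).coeff k).natDegree ≤ N := by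
  rw [natDegree_le_iff_coeff_eq_zero]
  intro j hj
  rw [coeff_coeff_genPoly, dif_neg (fun h => by omega)]

/-- Value of the generic polynomial at a point. [folklore] -/
theorem evalEval_genPoly (c : Fin (N + 1) × Fin (N + 1) → K) (a b : K) :
    (genPoly N c).evalEval a b = ∑ ij : Fin (N + 1) × Fin (N + 1),
      c ij * a ^ (ij.1 : ℕ) * b ^ (ij.2 : ℕ) := by
  rw [genPoly, ← coe_evalEvalRingHom, map_sum]
  refine Finset.sum_congr rfl fun ij _ => ?_
  simp only [coe_evalEvalRingHom, evalEval_mul, evalEval_pow, evalEval_C, eval_mul, eval_C,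
    eval_pow, eval_X, evalEval_X]

/-- Value of the `Y`-derivative of the generic polynomial at a point. [folklore] -/
theorem evalEval_derivative_genPoly (c : Fin (N + 1) × Fin (N + 1) → K) (a b : K) :
    (derivative (genPoly N c)).evalEval a b = ∑ ij : Fin (N + 1) × Fin (N + 1),
      c ij * a ^ (ij.1 : ℕ) * ((ij.2 : ℕ) * b ^ ((ij.2 : ℕ) - 1)) := by
  rw [genPoly, derivative_sum, ← coe_evalEvalRingHom, map_sum]
  refine Finset.sum_congr rfl fun ij _ => ?_
  simp only [derivative_mul, derivative_C, zero_mul, zero_add, derivative_X_pow,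
    coe_evalEvalRingHom, evalEval_mul, evalEval_pow, evalEval_C, eval_mul, eval_C, eval_pow,
    eval_X, evalEval_X, eval_natCast]

end GenPoly

section Definable

variable {α : Type} {N : ℕ}

/-- The free-ring element `Σ c_{ij} x^i y^j` in the variables `fc ij, fx, fy`. [folklore] -/
noncomputable def genPolyFR (N : ℕ) (fc : Fin (N + 1) × Fin (N + 1) → α) (fx fy : α) :
    FreeCommRing α :=
  ∑ ij : Fin (N + 1) × Fin (N + 1),
    FreeCommRing.of (fc ij) * FreeCommRing.of fx ^ (ij.1 : ℕ) * FreeCommRing.of fy ^ (ij.2 : ℕ)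

/-- The free-ring element `Σ c_{ij} x^i · j y^{j-1}`. [folklore] -/
noncomputable def genPolyDerivFR (N : ℕ) (fc : Fin (N + 1) × Fin (N + 1) → α) (fx fy : α) :
    FreeCommRing α :=
  ∑ ij : Fin (N + 1) × Fin (N + 1),
    FreeCommRing.of (fc ij) * FreeCommRing.of fx ^ (ij.1 : ℕ) *
      ((ij.2 : ℕ) * FreeCommRing.of fy ^ ((ij.2 : ℕ) - 1))

/-- Evaluating `genPolyFR` at a valuation gives the value of the generic polynomial. [folklore] -/
theorem lift_genPolyFR {K : Type*} [CommRing K] (fc : Fin (N + 1) × Fin (N + 1) → α) (fx fy : α)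
    (v : α → K) :
    FreeCommRing.lift v (genPolyFR N fc fx fy) = (genPoly N (v ∘ fc)).evalEval (v fx) (v fy) := by
  rw [genPolyFR, map_sum, evalEval_genPoly]
  simp

/-- Evaluating `genPolyDerivFR` at a valuation gives the value of the `Y`-derivative of the
generic polynomial. [folklore] -/
theorem lift_genPolyDerivFR {K : Type*} [CommRing K] (fc : Fin (N + 1) × Fin (N + 1) → α)
    (fx fy : α) (v : α → K) :
    FreeCommRing.lift v (genPolyDerivFR N fc fx fy) =
      (derivative (genPoly N (v ∘ fc))).evalEval (v fx) (v fy) := by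
  rw [genPolyDerivFR, map_sum, evalEval_derivative_genPoly]
  simp

/-- "`Σ c_{ij} x^i y^j = 0`" is definable. [folklore] -/
theorem definable_genPoly_eq_zero (N : ℕ) (fc : Fin (N + 1) × Fin (N + 1) → α) (fx fy : α) :
    ∃ θ : Language.ring.Formula α, ∀ (K : Type) [Field K] [CompatibleRing K] (v : α → K),
      θ.Realize v ↔ (genPoly N (v ∘ fc)).evalEval (v fx) (v fy) = 0 :=
  ⟨Term.equal (termOfFreeCommRing (genPolyFR N fc fx fy)) 0, fun K _ _ v => by
    rw [Formula.realize_equal, realize_termOfFreeCommRing, lift_genPolyFR, realize_zero]⟩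

/-- "`Σ c_{ij} x^i y^j ≠ 0`" is definable. [folklore] -/
theorem definable_genPoly_ne_zero (N : ℕ) (fc : Fin (N + 1) × Fin (N + 1) → α) (fx fy : α) :
    ∃ θ : Language.ring.Formula α, ∀ (K : Type) [Field K] [CompatibleRing K] (v : α → K),
      θ.Realize v ↔ (genPoly N (v ∘ fc)).evalEval (v fx) (v fy) ≠ 0 :=
  definable_not (definable_genPoly_eq_zero N fc fx fy)

/-- "`∂_Y (Σ c_{ij} x^i y^j) ≠ 0`" is definable. [folklore] -/
theorem definable_derivative_genPoly_ne_zero (N : ℕ) (fc : Fin (N + 1) × Fin (N + 1) → α)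
    (fx fy : α) :
    ∃ θ : Language.ring.Formula α, ∀ (K : Type) [Field K] [CompatibleRing K] (v : α → K),
      θ.Realize v ↔ (derivative (genPoly N (v ∘ fc))).evalEval (v fx) (v fy) ≠ 0 :=
  definable_not ⟨Term.equal (termOfFreeCommRing (genPolyDerivFR N fc fx fy)) 0, fun K _ _ v => by
    rw [Formula.realize_equal, realize_termOfFreeCommRing, lift_genPolyDerivFR, realize_zero]⟩

end Definable

section Transfer

variable {N : ℕ}

/-- The index type of the coefficient vector of `genPoly N`: exponent pairs `(i, j)`,
`i, j ≤ N`. [folklore] -/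
abbrev CoeffIdx (N : ℕ) : Type := Fin (N + 1) × Fin (N + 1)

/-- **Uniformly many points, transferred to pseudo-finite fields.**  For every pseudo-finite
field `K`, coefficient vectors `cF, cQ` of `Y`- and `X`-degrees `≤ N` and a point `(a, b)` with
`F(a,b) = 0`, `∂_Y F(a,b) ≠ 0`, `Q(a,b) ≠ 0` (`F = genPoly N cF`, `Q = genPoly N cQ`) there are
`n` distinct points of `{F = 0, Q ≠ 0}`, for every `n`: the statement is one ring formula in
`(cF, cQ, a, b)`, true in all finite fields with `≥ q₀(N, n)` elements
(`exists_le_ncard_zeros_of_nonsingular`). [folklore] -/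
theorem exists_points_genPoly_psf (N n : ℕ) (K : Type) [Field K] [CompatibleRing K] [Infinite K]
    (hK : K ⊨ finiteFieldTheory) (cF cQ : CoeffIdx N → K) (a b : K)
    (h0 : (genPoly N cF).evalEval a b = 0) (h1 : (derivative (genPoly N cF)).evalEval a b ≠ 0)
    (h2 : (genPoly N cQ).evalEval a b ≠ 0) :
    ∃ p : Fin n → Fin 2 → K, Function.Injective p ∧
      ∀ i, (genPoly N cF).evalEval (p i 0) (p i 1) = 0 ∧ (genPoly N cQ).evalEval (p i 0) (p i 1) ≠ 0 := by
  classical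
  -- variables: `cF`, `cQ`, `a = inr 0`, `b = inr 1`
  let α : Type := (CoeffIdx N ⊕ CoeffIdx N) ⊕ Fin 2
  -- the predicate
  let Prem : ∀ (K : Type) [Field K] [CompatibleRing K], (α → K) → Prop := fun K _ _ v =>
    (genPoly N (v ∘ Sum.inl ∘ Sum.inl)).evalEval (v (Sum.inr 0)) (v (Sum.inr 1)) = 0 ∧
    (derivative (genPoly N (v ∘ Sum.inl ∘ Sum.inl))).evalEval (v (Sum.inr 0)) (v (Sum.inr 1)) ≠ 0 ∧
    (genPoly N (v ∘ Sum.inl ∘ Sum.inr)).evalEval (v (Sum.inr 0)) (v (Sum.inr 1)) ≠ 0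
  let Concl : ∀ (K : Type) [Field K] [CompatibleRing K], (α → K) → Prop := fun K _ _ v =>
    ∃ p : Fin n → Fin 2 → K, Function.Injective p ∧
      ∀ i, (genPoly N (v ∘ Sum.inl ∘ Sum.inl)).evalEval (p i 0) (p i 1) = 0 ∧
        (genPoly N (v ∘ Sum.inl ∘ Sum.inr)).evalEval (p i 0) (p i 1) ≠ 0
  have hdef : ∃ θ : Language.ring.Formula α, ∀ (K : Type) [Field K] [CompatibleRing K]
      (v : α → K), θ.Realize v ↔ (Prem K v → Concl K v) := by
    refine definable_imp (definable_and (definable_genPoly_eq_zero N _ _ _)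
      (definable_and (definable_derivative_genPoly_ne_zero N _ _ _)
        (definable_genPoly_ne_zero N _ _ _))) ?_
    refine definable_exists₂ (β := Fin n) (γ := Fin 2)
      (P := fun K _ _ v p => Function.Injective p ∧
        ∀ i, (genPoly N (v ∘ Sum.inl ∘ Sum.inl)).evalEval (p i 0) (p i 1) = 0 ∧
          (genPoly N (v ∘ Sum.inl ∘ Sum.inr)).evalEval (p i 0) (p i 1) ≠ 0) ?_
    refine definable_and (definable_injective fun i l => Sum.inr (i, l)) ?_
    refine definable_iInf fun i => definable_and ?_ ?_
    · exact definable_genPoly_eq_zero N (fun ij => Sum.inl (Sum.inl (Sum.inl ij)))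
        (Sum.inr (i, 0)) (Sum.inr (i, 1))
    · exact definable_genPoly_ne_zero N (fun ij => Sum.inl (Sum.inl (Sum.inr ij)))
        (Sum.inr (i, 0)) (Sum.inr (i, 1))
  obtain ⟨θ, hθ⟩ := hdef
  -- truth in large finite fields
  obtain ⟨q₀, hq₀⟩ :=
    Literature.NumberTheory.DiophantineGeometry.PlaneShear.exists_le_ncard_zeros_of_nonsingular.{0} N n
  have hfin : ∀ (F : Type) [Field F] [Fintype F], q₀ ≤ Fintype.card F →
      ∀ v : α → F, (letI := compatibleRingOfRing F; θ.Realize v) := by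
    intro F _ _ hF v
    letI := compatibleRingOfRing F
    rw [hθ]
    rintro ⟨hv0, hv1, hv2⟩
    have hle := hq₀ F hF (genPoly N (v ∘ Sum.inl ∘ Sum.inl)) (genPoly N (v ∘ Sum.inl ∘ Sum.inr))
      (natDegree_genPoly_le _) (natDegree_coeff_genPoly_le _) (natDegree_genPoly_le _)
      (natDegree_coeff_genPoly_le _) _ _ hv0 hv1 hv2
    set S := {p : F × F | (genPoly N (v ∘ Sum.inl ∘ Sum.inl)).evalEval p.1 p.2 = 0 ∧
      (genPoly N (v ∘ Sum.inl ∘ Sum.inr)).evalEval p.1 p.2 ≠ 0} with hS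
    haveI : Fintype S := Fintype.ofFinite S
    have hcard : Fintype.card (Fin n) ≤ Fintype.card S := by
      rw [Fintype.card_fin, ← Nat.card_eq_fintype_card, Nat.card_coe_set_eq]; exact hle
    obtain ⟨e⟩ := Function.Embedding.nonempty_of_card_le hcard
    refine ⟨fun i => ![(e i).1.1, (e i).1.2], fun i i' h => ?_, fun i => ?_⟩
    · apply e.injective
      apply Subtype.ext
      exact Prod.ext (congrFun h 0) (congrFun h 1)
    · exact (e i).2
  -- transfer
  have hK' := realize_formula_of_forall_finite θ q₀ hfin K hK
    (Sum.elim (Sum.elim cF cQ) ![a, b])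
  rw [hθ] at hK'
  exact hK' ⟨h0, h1, h2⟩

/-- **A plane curve over a pseudo-finite field with a non-singular rational point has infinitely
many rational points off any curve not through... — precisely: `F(a,b) = 0`, `∂_Y F(a,b) ≠ 0`,
`Q(a,b) ≠ 0` imply that `{(a',b') | F(a',b') = 0, Q(a',b') ≠ 0}` is infinite.**  (Pseudo-finite
fields are PAC — Ax 1968 — of which this is the plane-curve case; here it is obtained by transfer
of the Weil bound.) [cite: Ax1968, §7–§8 (pseudo-finite fields are PAC)] -/
theorem planeCurve_infinite_of_nonsingular_psf (K : Type) [Field K] [CompatibleRing K] [Infinite K]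
    (hK : K ⊨ finiteFieldTheory) (F Q : K[X][Y]) (a b : K) (h0 : F.evalEval a b = 0)
    (h1 : (derivative F).evalEval a b ≠ 0) (h2 : Q.evalEval a b ≠ 0) :
    {p : K × K | F.evalEval p.1 p.2 = 0 ∧ Q.evalEval p.1 p.2 ≠ 0}.Infinite := by
  classical
  -- a common degree bound
  set N : ℕ := max (max F.natDegree (F.support.sup fun k => (F.coeff k).natDegree))
    (max Q.natDegree (Q.support.sup fun k => (Q.coeff k).natDegree)) with hN
  have hcoef : ∀ (G : K[X][Y]) (k : ℕ), (G.coeff k).natDegree ≤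
      G.support.sup fun k => (G.coeff k).natDegree := fun G k => by
    by_cases hk : G.coeff k = 0
    · rw [hk, natDegree_zero]; exact Nat.zero_le _
    · exact Finset.le_sup (f := fun k => (G.coeff k).natDegree) (mem_support_iff.2 hk)
  have hF : genPoly N (fun ij => (F.coeff ij.2).coeff ij.1) = F :=
    genPoly_coeff_eq F (le_max_of_le_left (le_max_left _ _))
      fun k => (hcoef F k).trans (le_max_of_le_left (le_max_right _ _))
  have hQ : genPoly N (fun ij => (Q.coeff ij.2).coeff ij.1) = Q :=
    genPoly_coeff_eq Q (le_max_of_le_right (le_max_left _ _))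
      fun k => (hcoef Q k).trans (le_max_of_le_right (le_max_right _ _))
  set S := {p : K × K | F.evalEval p.1 p.2 = 0 ∧ Q.evalEval p.1 p.2 ≠ 0} with hS
  intro hSfin
  obtain ⟨p, hpinj, hp⟩ := exists_points_genPoly_psf N (S.ncard + 1) K hK
    (fun ij => (F.coeff ij.2).coeff ij.1) (fun ij => (Q.coeff ij.2).coeff ij.1) a b
    (by rw [hF]; exact h0) (by rw [hF]; exact h1) (by rw [hQ]; exact h2)
  rw [hF, hQ] at hp
  let f : Fin (S.ncard + 1) → S := fun i => ⟨(p i 0, p i 1), hp i⟩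
  have hf : Function.Injective f := fun i i' h => hpinj (by
    have h' := congrArg Subtype.val h
    simp only [f, Prod.mk.injEq] at h'
    ext l; fin_cases l
    · exact h'.1
    · exact h'.2)
  haveI : Finite S := hSfin.to_subtype
  have := Nat.card_le_card_of_injective f hf
  rw [Nat.card_eq_fintype_card, Fintype.card_fin, Nat.card_coe_set_eq] at this
  omega

end Transfer

end Literature.ModelTheory.PseudofiniteFields
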